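import Summits.ValiantsHypothesis.ValiantsHypothesis.Theorems.OrderedCountWindowReservoir
import Literature.Barriers.PneNP.MonotoneGapPerfectMatchingProofs
import HarnessLib

/-!
# Ordered count window — `BalancedSegments` PROVED (K5); the reservoir theorem unconditionally:
`A_t = PerNotSumOrdered t` for EVERY support function `t` (lens 6, g8)

`Theorems/OrderedCountWindowReservoir.lean` closed the window modulo the typed finite piece
`BalancedSegments`.  This file PROVES it by exact counting over the `4^P` subsets of `Fin (P+P)`:
* `card_filter_inter_sdiff` — independence of disjoint pieces as a product count
  (`S ↦ (S ∩ A, S \ A)` is a bijection `𝒫(V) ≃ 𝒫(A) × 𝒫(V \ A)`);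
* `sixteen_mul_lowCount_le` — one `r`-segment (`r ≥ 1024`) has `≤ 2^r/16` traces of imbalance
  `< ⌊√r/32⌋` (at most `λ+1` binomials, each `≤ C(r,⌊r/2⌋)`, and `(r+1) C(r,⌊r/2⌋)² ≤ 4^r` —
  `Literature.Barriers.PneNP.succ_mul_choose_middle_sq_le` — with `256 (λ+1)² ≤ r`);
* `card_filter_forall_imb_lt_mul_le` — induction over a set `B` of disjoint segments: the subsets making
  every segment of `B` low-imbalance number `≤ 2^{|V|} / 16^{|B|}`;
* `balancedSegments` — a family of total imbalance `< qλ/2` has `> q/2` low segments, so its bad cuts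
  number `≤ C(q, q/2+1)·4^P/16^{q/2+1} ≤ 4^P/2^q`; the `P`-subsets number `C(2P,P) ≥ 4^P/(2P+1)`
  (`Nat.four_pow_le_two_mul_self_mul_centralBinom`); union bound with `#ι (2P+1) < 2^q`.

Consequence `perNotSumOrdered_all' (t) : PerNotSumOrdered t`: for every `c` and every `t : ℕ → ℕ` some
`per_n` is not a sum of `t n` ordered set-multilinear ABPs of total width `≤ n^c + c` — the whole
support-size dial of the lineage (kernel before: `t ≤ √n/2`; print: `t` sub-linear), the question left
open in [cite: ArvindRaja2016, §7 Remark 11] / [cite: ChatterjeeKushSarafShpilka2024, §1 p5].  It does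
NOT bear on `VP ≠ VNP`: the determinant obeys the same bound (LESSON 6 context for crux 23661).
-/

namespace Summit.ValiantsHypothesis.ValiantsHypothesis.Theorems.OrderedCountWindow

open Finset

/-! ## §1 Independence of disjoint pieces: a product count -/

section Product

variable {α : Type*} [DecidableEq α]

/-- `(T ∪ U) ∩ A = T` for `T ⊆ A` and `U` disjoint from `A`. [folklore] -/
theorem union_inter_eq_of_subset_of_disjoint {T U A : Finset α} (hT : T ⊆ A) (hU : Disjoint U A) :
    (T ∪ U) ∩ A = T := by
  ext x
  simp only [mem_inter, mem_union]
  constructor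
  · rintro ⟨hx | hx, hxA⟩
    · exact hx
    · exact absurd hxA (Finset.disjoint_left.1 hU hx)
  · exact fun hx => ⟨Or.inl hx, hT hx⟩

/-- `(T ∪ U) \ A = U` for `T ⊆ A` and `U` disjoint from `A`. [folklore] -/
theorem union_sdiff_eq_of_subset_of_disjoint {T U A : Finset α} (hT : T ⊆ A) (hU : Disjoint U A) :
    (T ∪ U) \ A = U := by
  ext x
  simp only [mem_sdiff, mem_union]
  constructor
  · rintro ⟨hx | hx, hxA⟩
    · exact absurd (hT hx) hxA
    · exact hx
  · exact fun hx => ⟨Or.inr hx, Finset.disjoint_left.1 hU hx⟩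

/-- **Product count.** For `A ⊆ V`, the subsets `S ⊆ V` with `R (S ∩ A)` and `Q (S \ A)` number
`#{T ⊆ A | R T} · #{U ⊆ V \ A | Q U}` (the bijection `S ↦ (S ∩ A, S \ A)`). [folklore] -/
theorem card_filter_inter_sdiff (V A : Finset α) (hAV : A ⊆ V) (R Q : Finset α → Prop)
    [DecidablePred R] [DecidablePred Q] :
    #(V.powerset.filter fun S => R (S ∩ A) ∧ Q (S \ A)) =
      #(A.powerset.filter R) * #((V \ A).powerset.filter Q) := by
  rw [← card_product]
  refine card_nbij' (fun S => (S ∩ A, S \ A)) (fun p => p.1 ∪ p.2) ?_ ?_ ?_ ?_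
  · intro S hS
    simp only [mem_coe, mem_filter, mem_powerset] at hS
    simp only [mem_coe, mem_product, mem_filter, mem_powerset]
    exact ⟨⟨inter_subset_right, hS.2.1⟩,
      fun x hx => mem_sdiff.2 ⟨hS.1 (mem_sdiff.1 hx).1, (mem_sdiff.1 hx).2⟩, hS.2.2⟩
  · rintro ⟨T, U⟩ hp
    simp only [mem_coe, mem_product, mem_filter, mem_powerset] at hp
    obtain ⟨⟨hT, hR⟩, hU, hQ⟩ := hp
    have hUA : Disjoint U A := Disjoint.mono_left hU disjoint_sdiff_self_left
    simp only [mem_coe, mem_filter, mem_powerset]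
    refine ⟨union_subset (hT.trans hAV) (hU.trans sdiff_subset), ?_, ?_⟩
    · rw [union_inter_eq_of_subset_of_disjoint hT hUA]; exact hR
    · rw [union_sdiff_eq_of_subset_of_disjoint hT hUA]; exact hQ
  · intro S _
    ext x
    simp only [mem_union, mem_inter, mem_sdiff]
    tauto
  · rintro ⟨T, U⟩ hp
    simp only [mem_coe, mem_product, mem_filter, mem_powerset] at hp
    obtain ⟨⟨hT, _⟩, hU, _⟩ := hp
    have hUA : Disjoint U A := Disjoint.mono_left hU disjoint_sdiff_self_left
    exact Prod.ext (union_inter_eq_of_subset_of_disjoint hT hUA)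
      (union_sdiff_eq_of_subset_of_disjoint hT hUA)

end Product

/-! ## §2 Imbalance as a function of the trace -/

variable {N : ℕ}

/-- `imb S A` depends only on the trace `S ∩ A`. [folklore] -/
theorem imb_eq_dist_card_inter (S A : Finset (Fin N)) :
    imb S A = (S ∩ A).card.dist (A.card - (S ∩ A).card) := by
  unfold imb
  have h := Finset.card_sdiff_add_card_inter A S
  rw [inter_comm S A]
  congr 1
  omega

/-- Removing a set disjoint from `A` does not change the imbalance against `A`. [folklore] -/
theorem imb_sdiff_of_disjoint (S A A₀ : Finset (Fin N)) (h : Disjoint A A₀) :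
    imb (S \ A₀) A = imb S A := by
  unfold imb
  have h1 : A ∩ (S \ A₀) = A ∩ S := by
    ext x
    simp only [mem_inter, mem_sdiff]
    constructor
    · rintro ⟨hxA, hxS, _⟩
      exact ⟨hxA, hxS⟩
    · rintro ⟨hxA, hxS⟩
      exact ⟨hxA, hxS, Finset.disjoint_left.1 h hxA⟩
  have h2 : A \ (S \ A₀) = A \ S := by
    ext x
    simp only [mem_sdiff]
    constructor
    · rintro ⟨hxA, hx⟩
      exact ⟨hxA, fun hxS => hx ⟨hxS, Finset.disjoint_left.1 h hxA⟩⟩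
    · rintro ⟨hxA, hxS⟩
      exact ⟨hxA, fun hx => hxS hx.1⟩
  rw [h1, h2]

/-! ## §3 One segment: few low-imbalance traces -/

/-- The number of traces `T ⊆ A` of imbalance `< lam`. -/
def lowCount (A : Finset (Fin N)) (lam : ℕ) : ℕ :=
  #(A.powerset.filter fun T => T.card.dist (A.card - T.card) < lam)

/-- At most `lam + 1` middle binomial coefficients. [folklore] -/
theorem lowCount_le (A : Finset (Fin N)) (lam : ℕ) :
    lowCount A lam ≤ (lam + 1) * A.card.choose (A.card / 2) := by
  set r := A.card with hr
  set K : Finset ℕ := (Finset.range (r + 1)).filter fun k => k.dist (r - k) < lam with hK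
  have hsub : A.powerset.filter (fun T => T.card.dist (r - T.card) < lam) ⊆
      K.biUnion fun k => powersetCard k A := by
    intro T hT
    rw [mem_filter, mem_powerset] at hT
    rw [mem_biUnion]
    refine ⟨T.card, ?_, ?_⟩
    · rw [hK, mem_filter, mem_range]
      exact ⟨Nat.lt_succ_of_le (hr ▸ card_le_card hT.1), hT.2⟩
    · rw [mem_powersetCard]
      exact ⟨hT.1, rfl⟩
  have hKc : K.card ≤ lam + 1 := by
    have hKs : K ⊆ Finset.Ico ((r - lam) / 2) ((r - lam) / 2 + (lam + 1)) := by
      intro k hk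
      rw [hK, mem_filter, mem_range] at hk
      rw [mem_Ico]
      unfold Nat.dist at hk
      omega
    refine (card_le_card hKs).trans ?_
    rw [Nat.card_Ico]
    omega
  calc lowCount A lam = #(A.powerset.filter fun T => T.card.dist (r - T.card) < lam) := rfl
    _ ≤ #(K.biUnion fun k => powersetCard k A) := card_le_card hsub
    _ ≤ ∑ k ∈ K, #(powersetCard k A) := card_biUnion_le
    _ = ∑ k ∈ K, r.choose k := sum_congr rfl fun k _ => by rw [card_powersetCard, hr]
    _ ≤ ∑ k ∈ K, r.choose (r / 2) := sum_le_sum fun k _ => Nat.choose_le_middle k r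
    _ = K.card * r.choose (r / 2) := by rw [sum_const, smul_eq_mul]
    _ ≤ (lam + 1) * r.choose (r / 2) := Nat.mul_le_mul_right _ hKc

/-- **One segment**: for `|A| = r ≥ 1024` and `λ = ⌊√r/32⌋`, `16 · lowCount A λ ≤ 2^r`
(`(λ+1) C(r,⌊r/2⌋) ≤ 2^r/16` from `(r+1) C(r,⌊r/2⌋)² ≤ 4^r` and `256 (λ+1)² ≤ r`). [folklore;
cf. ChatterjeeKushSarafShpilka2024, Claim 1] -/
theorem sixteen_mul_lowCount_le (A : Finset (Fin N)) (hr : 1024 ≤ A.card) :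
    16 * lowCount A (Nat.sqrt A.card / 32) ≤ 2 ^ A.card := by
  set r := A.card with hrdef
  have hs : 32 ≤ Nat.sqrt r := by
    rw [Nat.le_sqrt]
    omega
  have hss : Nat.sqrt r * Nat.sqrt r ≤ r := Nat.sqrt_le r
  have h1 : 32 * (Nat.sqrt r / 32 + 1) ≤ 2 * Nat.sqrt r := by omega
  have hlam : 256 * (Nat.sqrt r / 32 + 1) ^ 2 ≤ r := by
    have h2 := Nat.mul_le_mul h1 h1
    nlinarith [h2, hss]
  have hmid := Literature.Barriers.PneNP.succ_mul_choose_middle_sq_le r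
  have hsq : (16 * lowCount A (Nat.sqrt r / 32)) ^ 2 ≤ (2 ^ r) ^ 2 := by
    calc (16 * lowCount A (Nat.sqrt r / 32)) ^ 2
        ≤ (16 * ((Nat.sqrt r / 32 + 1) * r.choose (r / 2))) ^ 2 :=
          Nat.pow_le_pow_left (Nat.mul_le_mul_left _ (lowCount_le A _)) 2
      _ = 256 * (Nat.sqrt r / 32 + 1) ^ 2 * (r.choose (r / 2)) ^ 2 := by ring
      _ ≤ r * (r.choose (r / 2)) ^ 2 := Nat.mul_le_mul_right _ hlam
      _ ≤ (r + 1) * (r.choose (r / 2)) ^ 2 := Nat.mul_le_mul_right _ (Nat.le_succ r)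
      _ ≤ 4 ^ r := hmid
      _ = (2 ^ r) ^ 2 := by rw [sq, ← mul_pow]; norm_num
  exact (Nat.pow_le_pow_iff_left (by norm_num : (2 : ℕ) ≠ 0)).1 hsq

/-! ## §4 Several disjoint segments: the counts multiply -/

/-- For pairwise disjoint segments `Aseg m ⊆ V` (`m ∈ B`), each with `16 · lowCount ≤ 2^{|A|}`, the
subsets of `V` making EVERY segment of `B` low-imbalance number `≤ 2^{|V|} / 16^{|B|}`. [folklore;
cf. ChatterjeeKushSarafShpilka2024, proof of Lemma 4 (independence across the segments)] -/
theorem card_filter_forall_imb_lt_mul_le {κ : Type*} [DecidableEq κ] (lam : ℕ)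
    (Aseg : κ → Finset (Fin N)) (hlow : ∀ m, 16 * lowCount (Aseg m) lam ≤ 2 ^ (Aseg m).card)
    (hdisj : ∀ m m', m ≠ m' → Disjoint (Aseg m) (Aseg m')) :
    ∀ (B : Finset κ) (V : Finset (Fin N)), (∀ m ∈ B, Aseg m ⊆ V) →
      #(V.powerset.filter fun S => ∀ m ∈ B, imb S (Aseg m) < lam) * 16 ^ B.card ≤ 2 ^ V.card := by
  intro B
  induction B using Finset.induction_on with
  | empty =>
    intro V _
    simp
  | @insert m₀ B hm₀ ih =>
    intro V hV
    have hA₀V : Aseg m₀ ⊆ V := hV m₀ (mem_insert_self _ _)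
    have hBV : ∀ m ∈ B, Aseg m ⊆ V \ Aseg m₀ := by
      intro m hm x hx
      rw [mem_sdiff]
      refine ⟨hV m (mem_insert_of_mem hm) hx, fun hx' => ?_⟩
      have hne : m ≠ m₀ := fun h => hm₀ (h ▸ hm)
      exact Finset.disjoint_left.1 (hdisj m m₀ hne) hx hx'
    have hcongr : V.powerset.filter (fun S => ∀ m ∈ insert m₀ B, imb S (Aseg m) < lam) =
        V.powerset.filter (fun S =>
          (S ∩ Aseg m₀).card.dist ((Aseg m₀).card - (S ∩ Aseg m₀).card) < lam ∧
            ∀ m ∈ B, imb (S \ Aseg m₀) (Aseg m) < lam) := by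
      refine filter_congr fun S _ => ?_
      rw [forall_mem_insert, imb_eq_dist_card_inter]
      refine and_congr Iff.rfl (forall₂_congr fun m hm => ?_)
      have hne : m ≠ m₀ := fun h => hm₀ (h ▸ hm)
      rw [imb_sdiff_of_disjoint S (Aseg m) (Aseg m₀) (hdisj m m₀ hne)]
    rw [hcongr, card_filter_inter_sdiff V (Aseg m₀) hA₀V
      (fun T => T.card.dist ((Aseg m₀).card - T.card) < lam)
      (fun U => ∀ m ∈ B, imb U (Aseg m) < lam),
      card_insert_of_notMem hm₀, pow_succ]
    have h1 := hlow m₀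
    have h2 := ih (V \ Aseg m₀) hBV
    have hcard : (V \ Aseg m₀).card + (Aseg m₀).card = V.card :=
      card_sdiff_add_card_eq_card hA₀V
    calc #((Aseg m₀).powerset.filter fun T => T.card.dist ((Aseg m₀).card - T.card) < lam) *
          #((V \ Aseg m₀).powerset.filter fun U => ∀ m ∈ B, imb U (Aseg m) < lam) *
            (16 ^ B.card * 16)
        = (16 * lowCount (Aseg m₀) lam) *
            (#((V \ Aseg m₀).powerset.filter fun U => ∀ m ∈ B, imb U (Aseg m) < lam) *
              16 ^ B.card) := by
          unfold lowCount
          ring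
      _ ≤ 2 ^ (Aseg m₀).card * 2 ^ (V \ Aseg m₀).card := Nat.mul_le_mul h1 h2
      _ = 2 ^ V.card := by rw [← pow_add, add_comm, hcard]

/-! ## §5 The balancing lemma -/

/-- `4^P ≤ (2P+1) · C(2P, P)`. [folklore; Mathlib `Nat.four_pow_le_two_mul_self_mul_centralBinom`] -/
theorem four_pow_le_mul_choose (P : ℕ) : 4 ^ P ≤ (P + P + 1) * (P + P).choose P := by
  rcases Nat.eq_zero_or_pos P with rfl | hP
  · simp
  · have h := Nat.four_pow_le_two_mul_self_mul_centralBinom P hP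
    rw [Nat.centralBinom_eq_two_mul_choose, two_mul] at h
    exact h.trans (Nat.mul_le_mul_right _ (Nat.le_succ _))

/-- **K5 — the balancing lemma holds.** [cite: ChatterjeeKushSarafShpilka2024, Lemma 4 (p.15), Claim 1
(p.12) — the `k = 1`, alphabet-free core of its proof, here by exact counting] -/
theorem balancedSegments : BalancedSegments := by
  intro ι _ P q r A hr hι hcard hdisj
  set lam := Nat.sqrt r / 32 with hlam
  have hlow : ∀ i m, 16 * lowCount (A i m) lam ≤ 2 ^ (A i m).card := by
    intro i m
    have h := sixteen_mul_lowCount_le (A i m) (by rw [hcard]; exact hr)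
    rw [hcard i m] at h ⊢
    exact h
  let U : Finset (Fin (P + P)) := Finset.univ
  have hU : U.card = P + P := by simp [U]
  let Bad : ι → Finset (Finset (Fin (P + P))) := fun i =>
    U.powerset.filter fun S => 2 * ∑ m, imb S (A i m) < q * lam
  -- one family: few bad cuts
  have hBad : ∀ i, (Bad i).card * 2 ^ q ≤ 4 ^ P := by
    intro i
    set b := q / 2 + 1 with hb
    let E : Finset (Fin q) → Finset (Finset (Fin (P + P))) := fun B =>
      U.powerset.filter fun S => ∀ m ∈ B, imb S (A i m) < lam
    have hsub : Bad i ⊆ (powersetCard b (Finset.univ : Finset (Fin q))).biUnion E := by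
      intro S hS
      rw [mem_filter] at hS
      set L := Finset.univ.filter fun m : Fin q => imb S (A i m) < lam with hL
      have hLc : b ≤ L.card := by
        by_contra hlt
        push Not at hlt
        have hcompl : #(Finset.univ.filter fun m : Fin q => ¬ imb S (A i m) < lam) + L.card = q := by
          have := card_filter_add_card_filter_not
            (s := (Finset.univ : Finset (Fin q))) (fun m : Fin q => imb S (A i m) < lam)
          rw [← hL, card_univ, Fintype.card_fin] at this
          omega
        have hsum : (q - L.card) * lam ≤ ∑ m, imb S (A i m) := by
          calc (q - L.card) * lam
              = ∑ m ∈ Finset.univ.filter (fun m : Fin q => ¬ imb S (A i m) < lam), lam := by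
                rw [sum_const, smul_eq_mul]
                congr 1
                omega
            _ ≤ ∑ m ∈ Finset.univ.filter (fun m : Fin q => ¬ imb S (A i m) < lam), imb S (A i m) :=
                sum_le_sum fun m hm => not_lt.1 (mem_filter.1 hm).2
            _ ≤ ∑ m, imb S (A i m) := sum_le_sum_of_subset (filter_subset _ _)
        have hq : q ≤ 2 * (q - L.card) := by omega
        have hq' := Nat.mul_le_mul_right lam hq
        rw [mul_assoc] at hq'
        omega
      obtain ⟨B, hBL, hBc⟩ := exists_subset_card_eq hLc
      rw [mem_biUnion]
      refine ⟨B, ?_, ?_⟩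
      · rw [mem_powersetCard]
        exact ⟨subset_univ _, hBc⟩
      · rw [mem_filter]
        exact ⟨hS.1, fun m hm => (mem_filter.1 (hBL hm)).2⟩
    have hE : ∀ B : Finset (Fin q), (E B).card * 16 ^ B.card ≤ 4 ^ P := by
      intro B
      have h := card_filter_forall_imb_lt_mul_le lam (A i) (hlow i) (hdisj i) B U
        (fun m _ => subset_univ _)
      have h4 : (2 : ℕ) ^ (P + P) = 4 ^ P := by
        rw [← two_mul, pow_mul]
        norm_num
      rw [hU, h4] at h
      -- the `∀ m ∈ B` decidability instances differ (`Fin q` is a `Fintype`); `convert` bridges them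
      show #(U.powerset.filter fun S => ∀ m ∈ B, imb S (A i m) < lam) * 16 ^ B.card ≤ 4 ^ P
      convert h using 4
    have hE' : ∀ B ∈ powersetCard b (Finset.univ : Finset (Fin q)),
        (E B).card * (2 ^ q * 2 ^ q) ≤ 4 ^ P := by
      intro B hB
      have hBc : B.card = b := (mem_powersetCard.1 hB).2
      have h16 : 2 ^ q * 2 ^ q ≤ 16 ^ B.card := by
        rw [hBc, ← pow_add, show (16 : ℕ) = 2 ^ 4 by norm_num, ← pow_mul]
        exact Nat.pow_le_pow_right (by norm_num) (by omega)
      exact (Nat.mul_le_mul_left _ h16).trans (hE B)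
    have hsum : (∑ B ∈ powersetCard b (Finset.univ : Finset (Fin q)), (E B).card) * (2 ^ q * 2 ^ q)
        ≤ 2 ^ q * 4 ^ P := by
      calc (∑ B ∈ powersetCard b (Finset.univ : Finset (Fin q)), (E B).card) * (2 ^ q * 2 ^ q)
          = ∑ B ∈ powersetCard b (Finset.univ : Finset (Fin q)), (E B).card * (2 ^ q * 2 ^ q) :=
            sum_mul _ _ _
        _ ≤ ∑ B ∈ powersetCard b (Finset.univ : Finset (Fin q)), 4 ^ P := sum_le_sum hE'
        _ = q.choose b * 4 ^ P := by
            rw [sum_const, smul_eq_mul, card_powersetCard, card_univ, Fintype.card_fin]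
        _ ≤ 2 ^ q * 4 ^ P := Nat.mul_le_mul_right _ (Nat.choose_le_two_pow q b)
    have hle : (Bad i).card ≤ ∑ B ∈ powersetCard b (Finset.univ : Finset (Fin q)), (E B).card :=
      (card_le_card hsub).trans card_biUnion_le
    have h3 : (Bad i).card * 2 ^ q * 2 ^ q ≤ 4 ^ P * 2 ^ q := by
      calc (Bad i).card * 2 ^ q * 2 ^ q
          ≤ (∑ B ∈ powersetCard b (Finset.univ : Finset (Fin q)), (E B).card) * (2 ^ q * 2 ^ q) := by
            rw [mul_assoc]
            exact Nat.mul_le_mul_right _ hle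
        _ ≤ 2 ^ q * 4 ^ P := hsum
        _ = 4 ^ P * 2 ^ q := mul_comm _ _
    exact Nat.le_of_mul_le_mul_right h3 (by positivity)
  -- the good cuts are too many to be all bad
  have hgood : (powersetCard P U).card = (P + P).choose P := by
    rw [card_powersetCard, hU]
  by_contra hnone
  push Not at hnone
  have hcover : powersetCard P U ⊆ (Finset.univ : Finset ι).biUnion Bad := by
    intro S hS
    rw [mem_powersetCard] at hS
    obtain ⟨i, hi⟩ := hnone S hS.2
    rw [mem_biUnion]
    refine ⟨i, mem_univ _, ?_⟩
    rw [mem_filter]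
    exact ⟨mem_powerset.2 hS.1, hi⟩
  have h1 : (P + P).choose P ≤ ∑ i, (Bad i).card := by
    rw [← hgood]
    exact (card_le_card hcover).trans card_biUnion_le
  have h2 : (P + P).choose P * 2 ^ q ≤ Fintype.card ι * 4 ^ P := by
    calc (P + P).choose P * 2 ^ q ≤ (∑ i, (Bad i).card) * 2 ^ q := Nat.mul_le_mul_right _ h1
      _ = ∑ i, (Bad i).card * 2 ^ q := sum_mul _ _ _
      _ ≤ ∑ _i : ι, 4 ^ P := sum_le_sum fun i _ => hBad i
      _ = Fintype.card ι * 4 ^ P := by rw [sum_const, smul_eq_mul, card_univ]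
  have h3 : (P + P).choose P * 2 ^ q * (P + P + 1) < (P + P).choose P * 2 ^ q * (P + P + 1) := by
    calc (P + P).choose P * 2 ^ q * (P + P + 1)
        ≤ Fintype.card ι * 4 ^ P * (P + P + 1) := Nat.mul_le_mul_right _ h2
      _ = Fintype.card ι * (P + P + 1) * 4 ^ P := by ring
      _ < 2 ^ q * 4 ^ P := (Nat.mul_lt_mul_right (by positivity)).2 hι
      _ ≤ 2 ^ q * ((P + P + 1) * (P + P).choose P) := Nat.mul_le_mul_left _ (four_pow_le_mul_choose P)
      _ = (P + P).choose P * 2 ^ q * (P + P + 1) := by ring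
  exact lt_irrefl _ h3

/-! ## §6 The reservoir theorem, unconditionally -/

/-- **Reservoir inequality (finite form), unconditional.** [cite: ChatterjeeKushSarafShpilka2024, Lemma 4
(method); ArvindRaja2016, §7] -/
theorem two_pow_le_pow_of_isSumOrdered' {F : Type*} [Field F] {P q r t W : ℕ} (hN : P + P = q * r)
    (hr : 1024 ≤ r) (hW : W * (P + P + 1) < 2 ^ q) (h : IsSumOrdered F (P + P) t W) :
    2 ^ (q * (Nat.sqrt r / 32) / 4) ≤ W ^ (q + 1) :=
  two_pow_le_pow_of_isSumOrdered balancedSegments hN hr hW h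

/-- **The ordered-count window is CLOSED: `A_t` for every support function `t`.**  For every `c` and
every `t : ℕ → ℕ` there is `n` such that `per_n` is not a sum of `t n` ordered set-multilinear ABPs
(each in its own block order) of total width `≤ n^c + c`. [cite: ArvindRaja2016, §7 Remark 11 (the
question); ChatterjeeKushSarafShpilka2024, Thm 3 (the method)] -/
theorem perNotSumOrdered_all' (t : ℕ → ℕ) : PerNotSumOrdered t :=
  perNotSumOrdered_all balancedSegments t

end Summit.ValiantsHypothesis.ValiantsHypothesis.Theorems.OrderedCountWindow
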